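import Mathlib
import HarnessLib
import Summits.NavierStokesRegularity.NavierStokesRegularity.Theorems.UnthreadedDoorCellFluxDefs
import Literature.Analysis.Calculus.RealAnalyticCriticalValuesFinite
import Summits.NavierStokesRegularity.NavierStokesRegularity.Theorems.ThreadingFluxPrecessionConicalEulerTools

/-!
# Route `UnthreadedDoor`, crux `PoloidalLiouville` (stmt-NavierStokesRegularity-1222), WALL W1 — crux idea «indicatrix-bound», Λ-geo″:
# an analytic slice has finitely many sphere-critical VALUES on each sphere (M− Lean bridge from F3, Souček–Souček)

★ `analyticCriticalValuesFinite_of : <F3 `SoucekSoucek1972_criticalValues_finite` body verbatim> → ∀ x₀ f r, 0 < r → AnalyticOnNhd ℝ f {x₀}ᶜ →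
(f '' sphCrit f x₀ r).Finite` — the registered stub `stub_analyticCriticalValuesFinite : SoucekSoucek1972_criticalValues_finite → AnalyticCriticalValuesFinite`
of `Cruxes/PoloidalLiouville/IndicatrixSketch.lean` v1.7.3 (custodian ns-idea-14), both Props unfolded (the sketch's `sphCrit` is the CellFlux Defs twin's,
p692073), so the sketch closes it by the bare term; and ★ `analyticCriticalValuesFinite_of_realAnExp` — the same modulo the ONE standing named fact
`VandendriesMiller1994_realAnExp_isOMinimal`, through the landed F3 theorem `Literature.Analysis.Calculus.analytic_criticalValues_finite_of_realAnExp_isOMinimal`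
(p717471).

Proof = the custodian's Lagrange-multiplier recipe: on `E3 × ℝ` the function `L (x, μ) := f x − μ (‖x − x₀‖² − r²)` is analytic on the open set
`{x₀}ᶜ ×ˢ univ`; at a sphere-critical point the gradient is radial (`∇f x × (x − x₀) = 0`, `x ≠ x₀` ⇒ `∇f x = c • (x − x₀)`: `Precession.ConicalEuler.exists_eq_smul_of_cross_eq_zero`), so with
`μ := c/2` the derivative of `L` vanishes at `(x, μ)` and `L (x, μ) = f x`; `|μ| ≤ B/(2r)` with `B := sup_{S_r} ‖∇f‖`, so these points lie in the compact
`K := S_r × [−B/(2r), B/(2r)] ⊆ {x₀}ᶜ ×ˢ univ`, and F3 makes `L '' {q ∈ K | fderiv L q = 0} ⊇ f '' sphCrit` finite.  Pure calculus; nothing here is an NS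
statement; ⟨1222⟩ / W1 / NS regularity OPEN.  `--supports stmt-NavierStokesRegularity-1222 --as helper`.  [folklore]
-/

noncomputable section

-- the summit and its single sub-problem share the name (CONVENTIONS §1)
set_option linter.dupNamespace false

open Set Function Filter Topology MeasureTheory InnerProductSpace
open scoped RealInnerProductSpace

namespace Summit.NavierStokesRegularity.NavierStokesRegularity.Theorems.PoloidalLiouville.Indicatrix

open Summit.NavierStokesRegularity.NavierStokesRegularity.Theorems.PoloidalLiouville.NetFlux (E3)
open Summit.NavierStokesRegularity.NavierStokesRegularity.Theorems.PoloidalLiouville.CellFlux (sphCrit)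
open Literature.Analysis Literature.Analysis.FluidPDE

variable {x₀ : E3} {f : E3 → ℝ} {r : ℝ}

/-- `x ↦ ‖x − x₀‖²` is real-analytic on `E3` (a finite sum of squares of coordinate functionals). [folklore] -/
theorem analyticOnNhd_norm_sub_sq (x₀ : E3) : AnalyticOnNhd ℝ (fun x : E3 => ‖x - x₀‖ ^ 2) univ := by
  have hcoord : ∀ i : Fin 3, AnalyticOnNhd ℝ (fun x : E3 => (x - x₀) i) univ := fun i =>
    (EuclideanSpace.proj i : E3 →L[ℝ] ℝ).comp_analyticOnNhd (analyticOnNhd_id.sub analyticOnNhd_const)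
  have heq : (fun x : E3 => ‖x - x₀‖ ^ 2) = fun x => ∑ i, (x - x₀) i * (x - x₀) i := by
    funext x
    rw [EuclideanSpace.norm_eq, Real.sq_sqrt (Finset.sum_nonneg fun i _ => sq_nonneg _)]
    exact Finset.sum_congr rfl fun i _ => by rw [Real.norm_eq_abs, sq_abs, sq]
  rw [heq]
  exact Finset.analyticOnNhd_fun_sum _ fun i _ => (hcoord i).mul (hcoord i)

/-- The Lagrange function is analytic on `{x₀}ᶜ × ℝ` when `f` is analytic off the centre. [folklore] -/
theorem analyticOnNhd_lagrangeFun (hf : AnalyticOnNhd ℝ f ({x₀}ᶜ : Set E3)) :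
    AnalyticOnNhd ℝ (fun q : E3 × ℝ => f q.1 - q.2 * (‖q.1 - x₀‖ ^ 2 - r ^ 2))
      (({x₀}ᶜ : Set E3) ×ˢ (univ : Set ℝ)) := by
  have hfst : AnalyticOnNhd ℝ (fun q : E3 × ℝ => q.1) (({x₀}ᶜ : Set E3) ×ˢ (univ : Set ℝ)) :=
    (ContinuousLinearMap.fst ℝ E3 ℝ).analyticOnNhd _
  have hsnd : AnalyticOnNhd ℝ (fun q : E3 × ℝ => q.2) (({x₀}ᶜ : Set E3) ×ˢ (univ : Set ℝ)) :=
    (ContinuousLinearMap.snd ℝ E3 ℝ).analyticOnNhd _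
  have h1 : AnalyticOnNhd ℝ (fun q : E3 × ℝ => f q.1) (({x₀}ᶜ : Set E3) ×ˢ (univ : Set ℝ)) :=
    hf.comp hfst fun q hq => hq.1
  have h2 : AnalyticOnNhd ℝ (fun q : E3 × ℝ => ‖q.1 - x₀‖ ^ 2) (({x₀}ᶜ : Set E3) ×ˢ (univ : Set ℝ)) :=
    (analyticOnNhd_norm_sub_sq x₀).comp hfst fun q _ => mem_univ _
  exact h1.sub (hsnd.mul (h2.sub analyticOnNhd_const))

/-- The derivative of the Lagrange function at `(x, μ)`. [folklore] -/
theorem hasFDerivAt_lagrangeFun {x : E3} {μ : ℝ} (hfx : DifferentiableAt ℝ f x) :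
    HasFDerivAt (fun q : E3 × ℝ => f q.1 - q.2 * (‖q.1 - x₀‖ ^ 2 - r ^ 2))
      ((fderiv ℝ f x).comp (ContinuousLinearMap.fst ℝ E3 ℝ) -
        (μ • ((2 : ℝ) • innerSL ℝ (x - x₀)).comp (ContinuousLinearMap.fst ℝ E3 ℝ) +
          (‖x - x₀‖ ^ 2 - r ^ 2) • ContinuousLinearMap.snd ℝ E3 ℝ)) (x, μ) := by
  have hfst : HasFDerivAt (fun q : E3 × ℝ => q.1) (ContinuousLinearMap.fst ℝ E3 ℝ) (x, μ) := hasFDerivAt_fst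
  have hsnd : HasFDerivAt (fun q : E3 × ℝ => q.2) (ContinuousLinearMap.snd ℝ E3 ℝ) (x, μ) := hasFDerivAt_snd
  have h1 : HasFDerivAt (fun q : E3 × ℝ => f q.1) ((fderiv ℝ f x).comp (ContinuousLinearMap.fst ℝ E3 ℝ)) (x, μ) :=
    hfx.hasFDerivAt.comp (x, μ) hfst
  have h2 : HasFDerivAt (fun q : E3 × ℝ => ‖q.1 - x₀‖ ^ 2 - r ^ 2)
      (((2 : ℝ) • innerSL ℝ (x - x₀)).comp (ContinuousLinearMap.fst ℝ E3 ℝ)) (x, μ) := by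
    have h := ((hfst.sub_const x₀).norm_sq).sub_const (r ^ 2)
    dsimp only at h
    refine h.congr_fderiv ?_
    ext v
    · simp [two_smul]
    · simp
  have h3 := hsnd.mul h2
  exact h1.sub h3

/-- At a sphere point where the gradient is `(2μ) • (x − x₀)`, the derivative of the Lagrange function vanishes at `(x, μ)`. [folklore] -/
theorem fderiv_lagrangeFun_eq_zero {x : E3} {μ : ℝ} (hfx : DifferentiableAt ℝ f x) (hx : x ∈ Metric.sphere x₀ r)
    (hgrad : gradient f x = (2 * μ) • (x - x₀)) :
    fderiv ℝ (fun q : E3 × ℝ => f q.1 - q.2 * (‖q.1 - x₀‖ ^ 2 - r ^ 2)) (x, μ) = 0 := by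
  rw [(hasFDerivAt_lagrangeFun (r := r) (μ := μ) hfx).fderiv]
  have hsph : ‖x - x₀‖ ^ 2 - r ^ 2 = 0 := by
    rw [← dist_eq_norm, Metric.mem_sphere.1 hx]; ring
  rw [hsph, zero_smul, add_zero]
  have hq : ∀ w : E3, fderiv ℝ f x w = ⟪gradient f x, w⟫ := fun w => by
    rw [gradient, toDual_symm_apply]
  ext q
  · -- the `E3` component
    simp only [sub_apply, smul_apply, zero_apply, ContinuousLinearMap.comp_apply, ContinuousLinearMap.coe_fst',
      innerSL_apply_apply, ContinuousLinearMap.inl_apply, smul_eq_mul, hq, hgrad, real_inner_smul_left]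
    ring
  · -- the `ℝ` component
    simp only [sub_apply, smul_apply, zero_apply, ContinuousLinearMap.comp_apply, ContinuousLinearMap.coe_fst',
      innerSL_apply_apply, ContinuousLinearMap.inr_apply, smul_eq_mul, hq, inner_zero_right, mul_zero, sub_zero]

/-- ★ **Λ-geo″ as a bridge from F3**: Souček–Souček's finiteness of critical values (the body of `SoucekSoucek1972_criticalValues_finite`, verbatim) implies
that an analytic slice has finitely many sphere-critical values on each sphere (the body of `AnalyticCriticalValuesFinite`, verbatim). [folklore] -/
theorem analyticCriticalValuesFinite_of
    (hSS : ∀ (E : Type) [NormedAddCommGroup E] [NormedSpace ℝ E] [FiniteDimensional ℝ E] (D K : Set E) (f : E → ℝ),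
      IsOpen D → AnalyticOnNhd ℝ f D → IsCompact K → K ⊆ D → (f '' {x | x ∈ K ∧ fderiv ℝ f x = 0}).Finite) :
    ∀ (x₀ : E3) (f : E3 → ℝ) (r : ℝ), 0 < r → AnalyticOnNhd ℝ f ({x₀}ᶜ : Set E3) → (f '' sphCrit f x₀ r).Finite := by
  intro x₀ f r hr hf
  -- a bound of the gradient on the sphere
  have hsph : Metric.sphere x₀ r ⊆ ({x₀}ᶜ : Set E3) := fun x hx => Metric.ne_of_mem_sphere hx hr.ne'
  have hC1 : ContDiffOn ℝ 1 f ({x₀}ᶜ : Set E3) := hf.contDiffOn_of_completeSpace.of_le le_top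
  have hgradc : ContinuousOn (gradient f) ({x₀}ᶜ : Set E3) := by
    have h := hC1.continuousOn_fderiv_of_isOpen isOpen_compl_singleton le_rfl
    exact (toDual ℝ E3).symm.continuous.comp_continuousOn h
  obtain ⟨B, hB⟩ := (isCompact_sphere x₀ r).exists_bound_of_continuousOn (hgradc.mono hsph)
  -- the compact `K` and the open `D`
  set D : Set (E3 × ℝ) := ({x₀}ᶜ : Set E3) ×ˢ (univ : Set ℝ) with hD
  set K : Set (E3 × ℝ) := Metric.sphere x₀ r ×ˢ Icc (-(B / (2 * r))) (B / (2 * r)) with hK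
  have hDo : IsOpen D := isOpen_compl_singleton.prod isOpen_univ
  have hKc : IsCompact K := (isCompact_sphere x₀ r).prod isCompact_Icc
  have hKD : K ⊆ D := fun q hq => ⟨hsph hq.1, mem_univ _⟩
  have hfin := hSS (E3 × ℝ) D K (fun q : E3 × ℝ => f q.1 - q.2 * (‖q.1 - x₀‖ ^ 2 - r ^ 2)) hDo
    (analyticOnNhd_lagrangeFun hf) hKc hKD
  refine hfin.subset ?_
  rintro _ ⟨x, hx, rfl⟩
  obtain ⟨hxs, hcrit⟩ := hx
  have hx0 : x - x₀ ≠ 0 := sub_ne_zero.2 (hsph hxs)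
  obtain ⟨c, hc⟩ := Precession.ConicalEuler.exists_eq_smul_of_cross_eq_zero hx0 hcrit
  have hfx : DifferentiableAt ℝ f x := (hf x (hsph hxs)).differentiableAt
  -- the multiplier and its bound
  have hxr : ‖x - x₀‖ = r := by rw [← dist_eq_norm]; exact Metric.mem_sphere.1 hxs
  have hcB : |c| * r ≤ B := by
    have h := hB x hxs
    rwa [hc, norm_smul, Real.norm_eq_abs, hxr] at h
  have hμ : c / 2 ∈ Icc (-(B / (2 * r))) (B / (2 * r)) := by
    have h1 : |c| ≤ B / r := by rw [le_div_iff₀ hr]; exact hcB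
    have h2 : |c / 2| ≤ B / (2 * r) := by
      rw [abs_div, abs_two]
      calc |c| / 2 ≤ (B / r) / 2 := by linarith
        _ = B / (2 * r) := by field_simp
    exact abs_le.1 h2 |> fun h => ⟨h.1, h.2⟩
  refine ⟨(x, c / 2), ⟨⟨hxs, hμ⟩, ?_⟩, ?_⟩
  · exact fderiv_lagrangeFun_eq_zero hfx hxs (by rw [hc]; congr 1; ring)
  · show f x - c / 2 * (‖x - x₀‖ ^ 2 - r ^ 2) = f x
    rw [hxr]; ring

/-- ★ **Λ-geo″ modulo the one standing fact**: assuming the o-minimality of `ℝ_an,exp` (`VandendriesMiller1994_realAnExp_isOMinimal`), an analytic slice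
has finitely many sphere-critical values on each sphere — F3 is the landed theorem
`Literature.Analysis.Calculus.analytic_criticalValues_finite_of_realAnExp_isOMinimal` (p717471). [folklore] -/
theorem analyticCriticalValuesFinite_of_realAnExp
    (hO : Literature.ModelTheory.ExponentialFields.VandendriesMiller1994_realAnExp_isOMinimal) :
    ∀ (x₀ : E3) (f : E3 → ℝ) (r : ℝ), 0 < r → AnalyticOnNhd ℝ f ({x₀}ᶜ : Set E3) → (f '' sphCrit f x₀ r).Finite :=
  analyticCriticalValuesFinite_of (Literature.Analysis.Calculus.analytic_criticalValues_finite_of_realAnExp_isOMinimal hO)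

end Summit.NavierStokesRegularity.NavierStokesRegularity.Theorems.PoloidalLiouville.Indicatrix

end
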